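import Mathlib
import HarnessLib
import Summits.ValiantsHypothesis.ValiantsHypothesis.Theses.ValuativeGCT
import Summits.ValiantsHypothesis.ValiantsHypothesis.Theorems.ValuativeGCTValuativeBound
import Literature.Computability.Complexity.OccurrenceObstructionsBIP
import Literature.Computability.AlgebraicComplexity.OrbitCoordinateRingProofs
import Literature.NumberTheory.DiophantineGeometry.SchurWeylPlethysmOrbitWeightsProofs

/-!
# Certificates on points of `Δ(det_m)` are dominated by the valuative truncation
(no-go constraint for crux `ValuativeGCT.TailFlip`, stmt-ValiantsHypothesis-15687, line `Sketch` /
idea isobaric-anchors, open stub `stub_isobaricTailCensus`)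

A flip witness of the route compares `dim T_U(λ)` (the valuative truncation, verbatim the `T` of
`Theses.ValuativeGCT.ValuativeFlip / HeadFlip / TailFlip / ValuativeBound`) with a per-side
multiplicity that is certified FROM BELOW by an evaluation certificate: highest-weight vectors
`F₁ … F_D` of weight `λ* = partitionWeightLex m λ` of `ℂ[Sym^m ℂ^{m×m}]` (`coordRep`) and
points `p₁ … p_D` with nonsingular evaluation matrix `(F_i(p_l))_{i,l}`.  This file records the
constraint every such certificate must meet (the "`K_m` sandwich"):

* `evalRank_le_orbitMultiplicity_det_of_mem_orbitClosure` — if the points are forms of the orbit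
  CLOSURE `Δ(det_m) = orbitClosure (detFormLex ℂ m)`, the certificate bounds the DETERMINANT's
  multiplicity: `D ≤ K_m(λ*) = orbitMultiplicity ℂ (detFormLex ℂ m) m λ*` (every element of
  `I(GL · det_m)` vanishes at `formCoeff m q` for `q ∈ Δ(det_m)`,
  `aeval_formCoeff_eq_zero_of_mem_orbitClosure_detFormLex`, so the classes
  `[F_i] ∈ ℂ[Δ_m(det_m)]` are `D` independent highest-weight vectors — the closure-point form of
  the landed siege stub `stub_evalRankLowerBound`
  (`Theorems/ValuativeGCTValuativeFlipEvalRankLowerBoundK3.lean`) and of the certificate bridge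
  `le_orbitMultiplicity_of_closure_certificate`
  (`Theorems/ValuativeGCTValuativeFlipCertificateBridge.lean`), proof inlined);
* `certificate_le_finrank_truncation_of_mem_orbitClosure_det` — composed with the landed crux
  `ValuativeBound_proof` (`K_m(λ*) ≤ dim T_U(λ)`): `D ≤ dim T_U(λ)`, so such a certificate can
  never produce the flip inequality `dim T_U(λ) < D`;
* `exists_not_mem_orbitClosure_det_of_finrank_truncation_lt` — the contrapositive packaged for
  the flip body: a certificate `(F, p, det ≠ 0)` of size `D > dim T_U(λ)` has a point OUTSIDE
  `Δ(det_m)`.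

Consequence for the line (prose only): the isobaric block anchors
`X₀₀^j · x_t^{N-K} · (A_l · per_K)` of `stub_isobaricTailCensus` must lie outside
`Δ(det_{K+i+j})`; since `per_K` has a determinantal expression of size `2^K - 1` (Grenet),
padded products of it enter `Δ(det_m)` as soon as `m` exceeds the Grenet size plus the padding
bookkeeping, which forces `2^K - 1 + (N - K) > N + j`-type growth of the anchor size along the
tail.  Grenet's representation is not formalised here.

Sources: Mulmuley–Sohoni 2001 §4–5 (evaluation at closure points); BLMW 2011 (arXiv:0907.2850)
§4.4, §5.2; Bürgisser–Ikenmeyer STOC 2013 §2; Hüttenhain 2017 (arXiv:1512.04352) Thm 4 (the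
source of `ValuativeBound`); folklore plumbing over the tree.  No new definitions.
-/

-- `Summit.ValiantsHypothesis.ValiantsHypothesis.…` is the tree's mandated layout (Sub = Summit).
set_option linter.dupNamespace false

namespace Summit.ValiantsHypothesis.ValiantsHypothesis.Theorems.TailFlip

open MvPolynomial
open scoped BigOperators Matrix
open Literature.NumberTheory.DiophantineGeometry Literature.Computability.AlgebraicComplexity
  Literature.Computability.Complexity

noncomputable section

/-- **Closure-point evaluation engine for the determinant.**  Let `m ≠ 0`, `χ` a weight of
`GL_{m²}`, `F₁ … F_D ∈ ℂ[Sym^m ℂ^{m×m}]` highest-weight vectors of weight `χ` (`coordRep`) and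
`p₁ … p_D` forms of the orbit closure `Δ(det_m) = orbitClosure (detFormLex ℂ m)`.  If the
evaluation matrix `(F_i(p_l))_{i,l}` (at the degree-`m` coefficient vectors `formCoeff m (p l)`)
is nonsingular, then `D ≤ K_m(χ) = orbitMultiplicity ℂ (detFormLex ℂ m) m χ`: every element of
`I(GL · det_m)` vanishes at every point of the closure
(`aeval_formCoeff_eq_zero_of_mem_orbitClosure_detFormLex`), so a relation
`∑ c_i F_i ∈ I(GL · det_m)` is killed by the nonsingular matrix
(`Matrix.eq_zero_of_vecMul_eq_zero`): the classes
`[F_i] ∈ ℂ[Δ_m(det_m)] = ℂ[Sym^m] ⧸ I(GL · det_m)` are `D` linearly independent highest-weight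
vectors of weight `χ` (`orbitCoordRep_apply`, `orbitCoordSubst_mk`) of a space that is
finite-dimensional for `m ≠ 0` (`finiteDimensional_highestWeightSpace_orbitCoordRep_holds`).
Same proof as the landed siege stub `stub_evalRankLowerBound`, with closure points in place of
End-orbit points. [MulmuleySohoni2001 §4–5; BLMW2011 §5.2; Bürgisser–Ikenmeyer STOC 2013 §2;
folklore] -/
theorem evalRank_le_orbitMultiplicity_det_of_mem_orbitClosure
    (m : ℕ) (hm : m ≠ 0) (χ : Weight (MatIdx m)) (D : ℕ)
    (F : Fin D → MvPolynomial (DegIdx (MatIdx m) m) ℂ)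
    (hF : ∀ i, F i ∈ highestWeightSpace (coordRep (MatIdx m) ℂ m) χ)
    (p : Fin D → MvPolynomial (MatIdx m) ℂ) (hp : ∀ l, p l ∈ orbitClosure (detFormLex ℂ m))
    (hdet : (Matrix.of fun i l : Fin D =>
      MvPolynomial.aeval (formCoeff m (p l)) (F i)).det ≠ 0) :
    D ≤ orbitMultiplicity ℂ (detFormLex ℂ m) m χ := by
  -- the classes `[F_i]` are highest-weight vectors of weight `χ` in `ℂ[Δ_m(det_m)]`
  have hmk : ∀ i, (Ideal.Quotient.mk (orbitVanishingIdeal (detFormLex ℂ m) m) (F i) :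
      OrbitCoordRing (detFormLex ℂ m) m) ∈
        highestWeightSpace (orbitCoordRep (detFormLex ℂ m) m) χ := by
    intro i g hg
    rw [orbitCoordRep_apply, orbitCoordSubst_mk, ← coordRep_apply, hF i g hg]
    rw [← Ideal.Quotient.mkₐ_eq_mk ℂ, map_smul]
  -- the classes `[F_i]` are linearly independent: a relation lies in `I(GL · det_m)`, which
  -- vanishes at every point of the closure, so the row vector `c` is killed by the matrix
  have hli : LinearIndependent ℂ fun i =>
      (Ideal.Quotient.mk (orbitVanishingIdeal (detFormLex ℂ m) m) (F i) :
        OrbitCoordRing (detFormLex ℂ m) m) := by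
    rw [Fintype.linearIndependent_iff]
    intro c hc i
    have hmem : ∑ j, c j • F j ∈ orbitVanishingIdeal (detFormLex ℂ m) m := by
      rw [← Ideal.Quotient.eq_zero_iff_mem, ← Ideal.Quotient.mkₐ_eq_mk ℂ, map_sum]
      simp only [map_smul, Ideal.Quotient.mkₐ_eq_mk]
      exact hc
    have hvec : c ᵥ* (Matrix.of fun i l : Fin D =>
        MvPolynomial.aeval (formCoeff m (p l)) (F i)) = 0 := by
      funext l
      have h1 := aeval_formCoeff_eq_zero_of_mem_orbitClosure_detFormLex (hp l) hmem
      rw [map_sum] at h1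
      simp only [map_smul, smul_eq_mul] at h1
      rw [Pi.zero_apply, ← h1]
      rfl
    exact congr_fun (Matrix.eq_zero_of_vecMul_eq_zero hdet hvec) i
  -- lift to the highest-weight space, finite-dimensional for `m ≠ 0`
  have hv : LinearIndependent ℂ fun i =>
      (⟨Ideal.Quotient.mk (orbitVanishingIdeal (detFormLex ℂ m) m) (F i), hmk i⟩ :
        ↥(highestWeightSpace (orbitCoordRep (detFormLex ℂ m) m) χ)) :=
    LinearIndependent.of_comp (highestWeightSpace (orbitCoordRep (detFormLex ℂ m) m) χ).subtype hli
  haveI : FiniteDimensional ℂ ↥(highestWeightSpace (orbitCoordRep (detFormLex ℂ m) m) χ) :=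
    finiteDimensional_highestWeightSpace_orbitCoordRep_holds (detFormLex ℂ m) hm χ
  have hcard := hv.fintype_card_le_finrank
  rw [Fintype.card_fin] at hcard
  unfold orbitMultiplicity hwMultiplicity
  exact hcard

/-- **No-go: certificates on points of `Δ(det_m)` are dominated by the valuative truncation**
(the `K_m` sandwich).  For `m ≥ 1`, a linear space `U` of `m × m` matrices all of rank `≤ r`, a
degree `δ`, a shape `λ ⊢ m δ` with `≤ m²` parts, highest-weight vectors `F₁ … F_D` of weight
`λ* = partitionWeightLex m λ` and points `p₁ … p_D ∈ Δ(det_m)` with nonsingular evaluation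
matrix: `D ≤ dim T_U(λ)`, where `T` is VERBATIM the valuative truncation of the crux
(`Theses.ValuativeGCT.TailFlip`, `ValuativeFlip`, `ValuativeBound`).  Proof: `D ≤ K_m(λ*)`
(`evalRank_le_orbitMultiplicity_det_of_mem_orbitClosure`) and `K_m(λ*) ≤ dim T_U(λ)` (the landed
crux `ValuativeBound_proof`).  Hence every flip certificate for the tail — in particular the
isobaric anchors of line `Sketch` (stub `stub_isobaricTailCensus`) — must use evaluation points
OUTSIDE `Δ(det_m)`: points inside give `D ≤ K_m(λ*) ≤ dim T_U(λ)`, never `dim T_U(λ) < D`.  For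
block anchors `X₀₀^j · x_t^{N-K} · per_K` this forces `2^K - 1 + (N - K) > N + j`-type
constraints through Grenet's determinantal expression of `per_K` (prose; Grenet is not
formalised here). [Hüttenhain2017 Thm 4 via `ValuativeBound`; MulmuleySohoni2001 §4–5; folklore] -/
theorem certificate_le_finrank_truncation_of_mem_orbitClosure_det :
    ∀ (m : ℕ) [NeZero m] (U : Submodule ℂ (MatIdx m → ℂ)) (r : ℕ),
      (∀ u ∈ U, (Matrix.of fun a b : Fin m => u (toLex (a, b))).rank ≤ r) →
      ∀ (δ : ℕ) (lam : Nat.Partition (m * δ)), lam.parts.card ≤ m * m →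
      ∀ (D : ℕ) (F : Fin D → MvPolynomial (DegIdx (MatIdx m) m) ℂ),
        (∀ i, F i ∈ highestWeightSpace (coordRep (MatIdx m) ℂ m) (partitionWeightLex m lam)) →
        ∀ (p : Fin D → MvPolynomial (MatIdx m) ℂ),
          (∀ l, p l ∈ orbitClosure (detFormLex ℂ m)) →
          (Matrix.of fun i l : Fin D =>
            MvPolynomial.aeval (formCoeff m (p l)) (F i)).det ≠ 0 →
          let χ : Weight (MatIdx m) := (Weight.dualOfPartition (m * m) lam).toMatIdx;
          let T : Submodule ℂ (MvPolynomial (MatIdx m × MatIdx m) ℂ) :=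
            MvPolynomial.homogeneousSubmodule (MatIdx m × MatIdx m) ℂ (m * δ) ⊓
              ((MvPolynomial.vanishingIdeal ℂ
                {p : MatIdx m × MatIdx m → ℂ | ∀ j : MatIdx m, (fun i => p (j, i)) ∈ U}) ^
                  (δ * (m - r))).restrictScalars ℂ ⊓
              (⨅ (M : Matrix (MatIdx m) (MatIdx m) ℂ)
                (_ : linSubst (MatIdx m) ℂ M (detFormLex ℂ m) = detFormLex ℂ m),
                LinearMap.ker ((MvPolynomial.aeval (R := ℂ) fun p : MatIdx m × MatIdx m =>
                  ∑ l : MatIdx m, M l p.2 • MvPolynomial.X (p.1, l)).toLinearMap -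
                  LinearMap.id (R := ℂ) (M := MvPolynomial (MatIdx m × MatIdx m) ℂ))) ⊓
              (⨅ (g : Matrix.GeneralLinearGroup (MatIdx m) ℂ) (_ : IsUpperTriangular g),
                LinearMap.ker ((MvPolynomial.aeval (R := ℂ) fun p : MatIdx m × MatIdx m =>
                  ∑ l : MatIdx m, ((g⁻¹ : Matrix.GeneralLinearGroup (MatIdx m) ℂ) :
                    Matrix (MatIdx m) (MatIdx m) ℂ) p.1 l •
                      MvPolynomial.X (l, p.2)).toLinearMap -
                  weightChar χ g •
                    LinearMap.id (R := ℂ) (M := MvPolynomial (MatIdx m × MatIdx m) ℂ)));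
          D ≤ Module.finrank ℂ ↥T := by
  intro m _ U r hU δ lam hlam D F hF p hp hdet χ T
  have hK : orbitMultiplicity ℂ (detFormLex ℂ m) m χ ≤ Module.finrank ℂ ↥T :=
    Summit.ValiantsHypothesis.ValiantsHypothesis.Theorems.ValuativeBound.ValuativeBound_proof
      m U r hU δ lam hlam
  exact le_trans
    (evalRank_le_orbitMultiplicity_det_of_mem_orbitClosure m (NeZero.ne m) χ D F hF p hp hdet) hK

/-- **Contrapositive, packaged for the flip body.**  If a certificate `(F, p, det ≠ 0)` of weight
`λ*` has size `D` STRICTLY LARGER than `dim T_U(λ)` (the census inequality a flip witness needs,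
with `T` verbatim the crux's truncation written with `partitionWeightLex m λ = λ*`), then some
evaluation point `p l` lies OUTSIDE the orbit closure `Δ(det_m)`
(`certificate_le_finrank_truncation_of_mem_orbitClosure_det`). [folklore over `ValuativeBound`] -/
theorem exists_not_mem_orbitClosure_det_of_finrank_truncation_lt
    (m : ℕ) [NeZero m] (U : Submodule ℂ (MatIdx m → ℂ)) (r : ℕ)
    (hU : ∀ u ∈ U, (Matrix.of fun a b : Fin m => u (toLex (a, b))).rank ≤ r)
    (δ : ℕ) (lam : Nat.Partition (m * δ)) (hlam : lam.parts.card ≤ m * m)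
    (D : ℕ) (F : Fin D → MvPolynomial (DegIdx (MatIdx m) m) ℂ)
    (hF : ∀ i, F i ∈ highestWeightSpace (coordRep (MatIdx m) ℂ m) (partitionWeightLex m lam))
    (p : Fin D → MvPolynomial (MatIdx m) ℂ)
    (hdet : (Matrix.of fun i l : Fin D =>
      MvPolynomial.aeval (formCoeff m (p l)) (F i)).det ≠ 0)
    (hlt : Module.finrank ℂ
      ↥(MvPolynomial.homogeneousSubmodule (MatIdx m × MatIdx m) ℂ (m * δ) ⊓
        ((MvPolynomial.vanishingIdeal ℂ
          {p : MatIdx m × MatIdx m → ℂ | ∀ j : MatIdx m, (fun i => p (j, i)) ∈ U}) ^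
            (δ * (m - r))).restrictScalars ℂ ⊓
        (⨅ (M : Matrix (MatIdx m) (MatIdx m) ℂ)
          (_ : linSubst (MatIdx m) ℂ M (detFormLex ℂ m) = detFormLex ℂ m),
          LinearMap.ker ((MvPolynomial.aeval (R := ℂ) fun p : MatIdx m × MatIdx m =>
            ∑ l : MatIdx m, M l p.2 • MvPolynomial.X (p.1, l)).toLinearMap -
            LinearMap.id (R := ℂ) (M := MvPolynomial (MatIdx m × MatIdx m) ℂ))) ⊓
        (⨅ (g : Matrix.GeneralLinearGroup (MatIdx m) ℂ) (_ : IsUpperTriangular g),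
          LinearMap.ker ((MvPolynomial.aeval (R := ℂ) fun p : MatIdx m × MatIdx m =>
            ∑ l : MatIdx m, ((g⁻¹ : Matrix.GeneralLinearGroup (MatIdx m) ℂ) :
              Matrix (MatIdx m) (MatIdx m) ℂ) p.1 l • MvPolynomial.X (l, p.2)).toLinearMap -
            weightChar (partitionWeightLex m lam) g •
              LinearMap.id (R := ℂ) (M := MvPolynomial (MatIdx m × MatIdx m) ℂ)))) < D) :
    ∃ l, p l ∉ orbitClosure (detFormLex ℂ m) := by
  by_contra h
  simp only [not_exists, not_not] at h
  exact absurd hlt (not_lt.mpr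
    (certificate_le_finrank_truncation_of_mem_orbitClosure_det m U r hU δ lam hlam D F hF p h hdet))

end

end Summit.ValiantsHypothesis.ValiantsHypothesis.Theorems.TailFlip
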